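import Literature.Barriers.FinalStateConjecture.KleinGordonModeConstruction
import Mathlib.Analysis.Calculus.Deriv.Star
import Mathlib.Analysis.SpecialFunctions.Exp
import Mathlib.MeasureTheory.Integral.IntervalIntegral.FundThmCalculus
import HarnessLib

/-!
# Barrier catalogue `FinalStateConjecture`: Shlapentokh-Rothman's unstable Klein–Gordon modes —
# the microlocal energy current of the radial ODE and superradiance of unstable modes (Prop. 4.6)
(`Literature/Barriers/FinalStateConjecture/`, D-0021, D-0014; family `gr`; namespace
`Literature.Barriers.FinalStateConjecture`)

Shlapentokh-Rothman, Comm. Math. Phys. 329 (2014), Prop. 4.6 ("If `ε > 0` we must have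
`ω_R²(ε) + ε² < (am/2Mr₊)²`"): every mode solution of the radial ODE (2.2) in the upper half plane
(`Im ω = ε > 0`) is **superradiant**, `2Mr₊|ω| < |am|`. The printed proof: for the current
`Q̃_T = Im(Δ ∂ᵣR · \overline{ωR})` one has `Q̃_T(∞) = Q̃_T(r₊) = 0` and
`∂ᵣQ̃_T = -εΔ|∂ᵣR|² + Im(V_μ ω̄/Δ)|R|²`, so `∫ (εΔ|R'|² - Im(V_μ ω̄)|R|²/Δ) dr = 0`, while
`Im(-V_μ ω̄) = ε((r²+a²)²|ω|² - a²m² + Δr²μ²) - Δ Im((λ + a²ω²)ω̄)` is increasing in `r` once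
`-Im((λ + a²ω²)ω̄) > 0` (the angular input, Prop. B.2 = Prop. 8.2 of the held copy); hence
`R ≢ 0` forces `Im(-V_μ ω̄)(r₊) < 0`, i.e. `ω_R² + ε² < (am/2Mr₊)²`. This file proves it in the
vocabulary of `KleinGordonModeConstruction.lean` (`kgRadialPotential`, `IsRadialSolution`), with the
angular inequality as an explicit hypothesis and the boundary behaviour of the mode as hypotheses in
the form delivered by the mode construction (`Δ R' R̄ → 0` at `r₊⁺`; exponential decay of `R`, `R'`
at infinity):

* `im_neg_kgRadialPotential_mul_conj` — the displayed formula for `Im(-V_μ ω̄)`;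
* `im_neg_kgRadialPotential_mul_conj_rPlus`, `im_neg_kgRadialPotential_mul_conj_lt` — its value
  `ε((2Mr₊)²|ω|² - a²m²)` at `r₊` and its strict monotonicity in `r ≥ r₊`;
* `hasDerivAt_radialFlux`, `hasDerivAt_radialCurrent` — `(Δ R')' = (V_μ/Δ) R` and
  `∂ᵣ Im(Δ R' \overline{ωR}) = Im(V_μ ω̄)|R|²/Δ - εΔ|R'|²` on `(r₊, ∞)`;
* `superradiant_of_isRadialSolution` — **Prop. 4.6**: `2Mr₊‖ω‖ < |am|`. (No improper integrals
  are needed: if `Im(-V_μ ω̄) > 0` on `(r₊, ∞)`, then `-∂ᵣQ̃_T ≥ 0` has positive integral `γ` over a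
  window where `R ≠ 0`, so `Q̃_T(r₁) ≥ γ + Q̃_T(T)` for `r₁` near `r₊` and `T` large, contradicting
  the two boundary limits.)

Everything is proved; no named facts are introduced.

## References

* Y. Shlapentokh-Rothman, *Exponentially growing finite energy solutions for the Klein–Gordon
  equation on sub-extremal Kerr spacetimes*, Comm. Math. Phys. 329 (2014) 859–891,
  arXiv:1302.3448: §3.1 (the current `Q_T`), §4.4 Prop. 4.6 (held copy `paper:arxiv-1302.3448`,
  p. 12), App. B Prop. B.2 (= Prop. 8.2 of the held copy, p. 17).
  Key `ShlapentokhRothman2014KleinGordon`.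
-/

noncomputable section

open Set Filter MeasureTheory intervalIntegral
open scoped Topology Real ContDiff ComplexConjugate

namespace Literature.Barriers.FinalStateConjecture

open Literature.Geometry.Lorentzian

/-! ### The sign of `Im(-V_μ ω̄)` -/

section Potential

variable (M a : ℝ) (w : ℂ) (m : ℤ) (Λ : ℂ) (μ : ℝ)

/-- **`Im(-V_μ ω̄) = ε((r²+a²)²|ω|² - a²m² + Δμ²r²) - Δ·Im((λ + a²ω²)ω̄)`** (`ε = Im ω`).
Shlapentokh-Rothman, CMP 329 (2014), proof of Prop. 4.6.
[cite: ShlapentokhRothman2014KleinGordon, Prop. 4.6 (proof)] -/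
theorem im_neg_kgRadialPotential_mul_conj (r : ℝ) :
    (-(kgRadialPotential M a w m Λ μ r) * conj w).im =
      w.im * ((r ^ 2 + a ^ 2) ^ 2 * ‖w‖ ^ 2 - a ^ 2 * (m : ℝ) ^ 2 + Kerr.delta M a r * (μ ^ 2 * r ^ 2)) -
        Kerr.delta M a r * ((Λ + ((a ^ 2 : ℝ) : ℂ) * w ^ 2) * conj w).im := by
  have hn : (w * conj w) = ((‖w‖ ^ 2 : ℝ) : ℂ) := by
    rw [Complex.mul_conj, Complex.normSq_eq_norm_sq]
  have key : -(kgRadialPotential M a w m Λ μ r) * conj w =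
      ((((r ^ 2 + a ^ 2) ^ 2 * ‖w‖ ^ 2 : ℝ)) : ℂ) * w - ((4 * M * a * m * r * ‖w‖ ^ 2 : ℝ) : ℂ)
        + ((a ^ 2 * (m : ℝ) ^ 2 : ℝ) : ℂ) * conj w
        - ((Kerr.delta M a r : ℝ) : ℂ) * ((Λ + ((a ^ 2 : ℝ) : ℂ) * w ^ 2) * conj w)
        - ((Kerr.delta M a r * (μ ^ 2 * r ^ 2) : ℝ) : ℂ) * conj w := by
    unfold kgRadialPotential
    have e1 : ((((r ^ 2 + a ^ 2) ^ 2 * ‖w‖ ^ 2 : ℝ)) : ℂ) * w =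
        (((r ^ 2 + a ^ 2) ^ 2 : ℝ) : ℂ) * w * (w * conj w) := by rw [hn]; push_cast; ring
    have e2 : ((4 * M * a * m * r * ‖w‖ ^ 2 : ℝ) : ℂ) =
        ((4 * M * a * m * r : ℝ) : ℂ) * (w * conj w) := by
      rw [hn]; push_cast; ring
    rw [e1, e2]
    push_cast
    ring
  rw [key]
  simp only [Complex.sub_im, Complex.add_im, Complex.mul_im, Complex.ofReal_re, Complex.ofReal_im,
    Complex.conj_re, Complex.conj_im, zero_mul, add_zero, sub_zero]
  ring

variable {M a}

/-- **The value at the horizon**: `Im(-V_μ ω̄)(r₊) = ε((2Mr₊)²|ω|² - a²m²)` (`Δ(r₊) = 0`,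
`r₊² + a² = 2Mr₊`). [cite: ShlapentokhRothman2014KleinGordon, Prop. 4.6 (proof)] -/
theorem im_neg_kgRadialPotential_mul_conj_rPlus (hMa : Kerr.IsSubextremal M a) :
    (-(kgRadialPotential M a w m Λ μ (Kerr.rPlus M a)) * conj w).im =
      w.im * ((2 * M * Kerr.rPlus M a) ^ 2 * ‖w‖ ^ 2 - a ^ 2 * (m : ℝ) ^ 2) := by
  rw [im_neg_kgRadialPotential_mul_conj, Kerr.delta_rPlus hMa.le]
  have h : Kerr.rPlus M a ^ 2 + a ^ 2 = 2 * M * Kerr.rPlus M a := by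
    have := hMa.rPlus_sq; linarith
  rw [h]
  ring

/-- **Monotonicity**: for `Im ω > 0` and `Im((λ + a²ω²)ω̄) < 0`, the function `r ↦ Im(-V_μ ω̄)(r)`
is strictly increasing on `[r₊, ∞)` (each of `(r²+a²)²`, `Δ r²`, `Δ` is nondecreasing there and `Δ`
strictly increasing). [cite: ShlapentokhRothman2014KleinGordon, Prop. 4.6 (proof)] -/
theorem im_neg_kgRadialPotential_mul_conj_lt (hMa : Kerr.IsSubextremal M a) (hw : 0 < w.im)
    (hΛ : ((Λ + ((a ^ 2 : ℝ) : ℂ) * w ^ 2) * conj w).im < 0) {r s : ℝ}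
    (hr : Kerr.rPlus M a ≤ r) (hrs : r < s) :
    (-(kgRadialPotential M a w m Λ μ r) * conj w).im <
      (-(kgRadialPotential M a w m Λ μ s) * conj w).im := by
  rw [im_neg_kgRadialPotential_mul_conj, im_neg_kgRadialPotential_mul_conj]
  set k : ℝ := ((Λ + ((a ^ 2 : ℝ) : ℂ) * w ^ 2) * conj w).im with hk
  have hM : 0 < M := hMa.pos
  have hMr : M < Kerr.rPlus M a := hMa.M_lt_rPlus
  have hr0 : 0 < r := hMa.rPlus_pos.trans_le hr
  have hΔr : 0 ≤ Kerr.delta M a r := Kerr.delta_nonneg hMa.le hr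
  have hΔ : Kerr.delta M a r < Kerr.delta M a s := by
    have : Kerr.delta M a s - Kerr.delta M a r = (s - r) * (s + r - 2 * M) := by
      unfold Kerr.delta; ring
    nlinarith
  have h1 : (r ^ 2 + a ^ 2) ^ 2 ≤ (s ^ 2 + a ^ 2) ^ 2 := by
    have : r ^ 2 ≤ s ^ 2 := by nlinarith
    nlinarith
  have h2 : Kerr.delta M a r * (μ ^ 2 * r ^ 2) ≤ Kerr.delta M a s * (μ ^ 2 * s ^ 2) := by
    have hrs2 : μ ^ 2 * r ^ 2 ≤ μ ^ 2 * s ^ 2 := by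
      have : r ^ 2 ≤ s ^ 2 := by nlinarith
      exact mul_le_mul_of_nonneg_left this (sq_nonneg _)
    exact mul_le_mul hΔ.le hrs2 (by positivity) (hΔr.trans hΔ.le)
  have hn : 0 ≤ ‖w‖ ^ 2 := sq_nonneg _
  nlinarith [mul_le_mul_of_nonneg_left h1 hn, mul_pos (neg_pos.2 hΛ) (sub_pos.2 hΔ)]

/-- Consequently, if `Im(-V_μ ω̄)(r₊) ≥ 0` then `Im(-V_μ ω̄) > 0` on `(r₊, ∞)`.
[cite: ShlapentokhRothman2014KleinGordon, Prop. 4.6 (proof)] -/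
theorem im_neg_kgRadialPotential_mul_conj_pos (hMa : Kerr.IsSubextremal M a) (hw : 0 < w.im)
    (hΛ : ((Λ + ((a ^ 2 : ℝ) : ℂ) * w ^ 2) * conj w).im < 0)
    (h0 : 0 ≤ (-(kgRadialPotential M a w m Λ μ (Kerr.rPlus M a)) * conj w).im) {r : ℝ}
    (hr : Kerr.rPlus M a < r) : 0 < (-(kgRadialPotential M a w m Λ μ r) * conj w).im :=
  h0.trans_lt (im_neg_kgRadialPotential_mul_conj_lt w m Λ μ hMa hw hΛ le_rfl hr)

end Potential

/-! ### The flux `Δ R'` and the current `Im(Δ R' \overline{ωR})` -/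

section Current

variable {M a : ℝ} {w Λ : ℂ} {m : ℤ} {μ : ℝ} {R : ℝ → ℂ}

/-- The complexified `Δ` is differentiable. [folklore] -/
theorem hasDerivAt_delta_ofReal (M a r : ℝ) :
    HasDerivAt (fun s : ℝ ↦ ((Kerr.delta M a s : ℝ) : ℂ)) (((2 * (r - M) : ℝ) : ℂ)) r :=
  (Kerr.hasDerivAt_delta M a r).ofReal_comp

/-- For a radial solution, `R` and `R'` are differentiable on `(r₊, ∞)` with the expected
derivatives. [folklore] -/
theorem IsRadialSolution.hasDerivAt (hR : IsRadialSolution M a w m Λ μ R) {r : ℝ}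
    (hr : Kerr.rPlus M a < r) :
    HasDerivAt R (deriv R r) r ∧ HasDerivAt (deriv R) (deriv (deriv R) r) r := by
  have hC : ContDiffAt ℝ ∞ R r := hR.1.contDiffAt (Ioi_mem_nhds hr)
  refine ⟨(hC.differentiableAt (by simp)).hasDerivAt, ?_⟩
  have h2 : ContDiffAt ℝ 2 R r := hC.of_le (WithTop.coe_le_coe.2 le_top)
  exact ((h2.derivWithin (m := 1) (by norm_num)).differentiableAt one_ne_zero).hasDerivAt

/-- **The flux equation `(Δ R')' = (V_μ/Δ) R`** on `(r₊, ∞)` for a solution of the radial ODE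
(2.2) `Δ (Δ R')' = V_μ R`. [cite: ShlapentokhRothman2014KleinGordon, §2 (2.2)] -/
theorem hasDerivAt_radialFlux (hMa : Kerr.IsSubextremal M a) (hR : IsRadialSolution M a w m Λ μ R)
    {r : ℝ} (hr : Kerr.rPlus M a < r) :
    HasDerivAt (fun s : ℝ ↦ ((Kerr.delta M a s : ℝ) : ℂ) * deriv R s)
      (kgRadialPotential M a w m Λ μ r * R r / ((Kerr.delta M a r : ℝ) : ℂ)) r := by
  have hΔ : ((Kerr.delta M a r : ℝ) : ℂ) ≠ 0 :=
    Complex.ofReal_ne_zero.2 (Kerr.delta_pos hMa.le hr).ne'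
  have hF : HasDerivAt (fun s : ℝ ↦ ((Kerr.delta M a s : ℝ) : ℂ) * deriv R s)
      (deriv (fun s : ℝ ↦ ((Kerr.delta M a s : ℝ) : ℂ) * deriv R s) r) r :=
    ((hasDerivAt_delta_ofReal M a r).mul (hR.hasDerivAt hr).2).differentiableAt.hasDerivAt
  have heq := hR.2 r hr
  convert hF using 1
  rw [div_eq_iff hΔ, ← heq]
  exact mul_comm _ _

/-- **The derivative of the current.** For a radial solution and any `ω`,
`d/dr Im(Δ R' · ω̄ R̄) = Im(V_μ ω̄) |R|²/Δ - Im(ω) Δ |R'|²` on `(r₊, ∞)`.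
Shlapentokh-Rothman, CMP 329 (2014), proof of Prop. 4.6 (`∂ᵣQ̃_T = -εΔ|∂ᵣR|² + Im(V_μω̄/Δ)|R|²`).
[cite: ShlapentokhRothman2014KleinGordon, Prop. 4.6 (proof)] -/
theorem hasDerivAt_radialCurrent (hMa : Kerr.IsSubextremal M a) (hR : IsRadialSolution M a w m Λ μ R)
    {r : ℝ} (hr : Kerr.rPlus M a < r) :
    HasDerivAt (fun s : ℝ ↦ (((Kerr.delta M a s : ℝ) : ℂ) * deriv R s * (conj w * conj (R s))).im)
      ((kgRadialPotential M a w m Λ μ r * conj w).im * ‖R r‖ ^ 2 / Kerr.delta M a r -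
        w.im * Kerr.delta M a r * ‖deriv R r‖ ^ 2) r := by
  have hΔpos : 0 < Kerr.delta M a r := Kerr.delta_pos hMa.le hr
  have hΔ : ((Kerr.delta M a r : ℝ) : ℂ) ≠ 0 := Complex.ofReal_ne_zero.2 hΔpos.ne'
  have hflux := hasDerivAt_radialFlux hMa hR hr
  have hRc : HasDerivAt (fun s ↦ conj (R s)) (conj (deriv R r)) r := by
    have h := (hR.hasDerivAt hr).1.star
    simpa using h
  have hK : HasDerivAt
      (fun s : ℝ ↦ ((Kerr.delta M a s : ℝ) : ℂ) * deriv R s * (conj w * conj (R s)))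
      (kgRadialPotential M a w m Λ μ r * R r / ((Kerr.delta M a r : ℝ) : ℂ) * (conj w * conj (R r)) +
        ((Kerr.delta M a r : ℝ) : ℂ) * deriv R r * (conj w * conj (deriv R r))) r :=
    hflux.fun_mul (hRc.const_mul (conj w))
  have him : HasDerivAt
      (fun s : ℝ ↦ (((Kerr.delta M a s : ℝ) : ℂ) * deriv R s * (conj w * conj (R s))).im)
      (kgRadialPotential M a w m Λ μ r * R r / ((Kerr.delta M a r : ℝ) : ℂ) * (conj w * conj (R r)) +
        ((Kerr.delta M a r : ℝ) : ℂ) * deriv R r * (conj w * conj (deriv R r))).im r :=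
    Complex.imCLM.hasFDerivAt.comp_hasDerivAt r hK
  refine him.congr_deriv ?_
  -- the algebra: `Im((V R/Δ) ω̄ R̄ + Δ R' ω̄ conj R') = Im(V ω̄)|R|²/Δ - Im ω Δ |R'|²`
  have hRR : R r * conj (R r) = ((‖R r‖ ^ 2 : ℝ) : ℂ) := by
    rw [Complex.mul_conj, Complex.normSq_eq_norm_sq]
  have hR'R' : deriv R r * conj (deriv R r) = ((‖deriv R r‖ ^ 2 : ℝ) : ℂ) := by
    rw [Complex.mul_conj, Complex.normSq_eq_norm_sq]
  have e1 : kgRadialPotential M a w m Λ μ r * R r / ((Kerr.delta M a r : ℝ) : ℂ) *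
      (conj w * conj (R r)) =
      kgRadialPotential M a w m Λ μ r * conj w * (((‖R r‖ ^ 2 / Kerr.delta M a r : ℝ)) : ℂ) := by
    rw [Complex.ofReal_div, ← hRR]
    field_simp
  have e2 : ((Kerr.delta M a r : ℝ) : ℂ) * deriv R r * (conj w * conj (deriv R r)) =
      conj w * ((Kerr.delta M a r * ‖deriv R r‖ ^ 2 : ℝ) : ℂ) := by
    rw [Complex.ofReal_mul, ← hR'R']
    ring
  rw [e1, e2]
  simp only [Complex.add_im, Complex.mul_im, Complex.ofReal_re, Complex.ofReal_im, Complex.conj_re,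
    Complex.conj_im, mul_zero, zero_add]
  ring

end Current

/-! ### Prop. 4.6: unstable modes are superradiant -/

section Superradiance

variable {M a : ℝ} {w Λ : ℂ} {m : ℤ} {μ : ℝ} {R : ℝ → ℂ}

/-- `Δ(T) e^{-2κT} → 0` as `T → ∞` (`κ > 0`). [folklore] -/
theorem tendsto_delta_mul_exp_neg (M a : ℝ) {κ : ℝ} (hκ : 0 < κ) :
    Tendsto (fun T : ℝ ↦ Kerr.delta M a T * Real.exp (-(2 * κ * T))) atTop (𝓝 0) := by
  -- `Δ(T) = T² - 2MT + a²`; each of `T² e^{-cT}`, `T e^{-cT}`, `e^{-cT}` tends to `0`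
  have hc : 0 < 2 * κ := by positivity
  have hlin : Tendsto (fun T : ℝ ↦ 2 * κ * T) atTop atTop := tendsto_id.const_mul_atTop hc
  have hpow : ∀ n : ℕ, Tendsto (fun T : ℝ ↦ T ^ n * Real.exp (-(2 * κ * T))) atTop (𝓝 0) := by
    intro n
    have h := (Real.tendsto_pow_mul_exp_neg_atTop_nhds_zero n).comp hlin
    have h' : Tendsto (fun T : ℝ ↦ (1 / (2 * κ) ^ n) * ((2 * κ * T) ^ n * Real.exp (-(2 * κ * T))))
        atTop (𝓝 (1 / (2 * κ) ^ n * 0)) := h.const_mul _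
    rw [mul_zero] at h'
    refine h'.congr fun T ↦ ?_
    have : (2 * κ) ^ n ≠ 0 := pow_ne_zero _ hc.ne'
    field_simp
    ring
  have h2 := hpow 2
  have h1 := hpow 1
  have h0 := hpow 0
  simp only [pow_one] at h1
  simp only [pow_zero, one_mul] at h0
  have h := ((h2.sub (h1.const_mul (2 * M))).add (h0.const_mul (a ^ 2)))
  simp only [mul_zero, sub_zero, zero_add] at h
  refine h.congr fun T ↦ ?_
  unfold Kerr.delta
  ring

/-- **Unstable modes are superradiant** (Shlapentokh-Rothman, CMP 329 (2014), Prop. 4.6). Let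
`(M, a)` be sub-extremal, `Im ω > 0`, and let the angular parameter satisfy
`Im((λ + a²ω²)ω̄) < 0` (Prop. B.2, the input from the angular equation). Let `R` solve the radial
ODE (2.2) on `(r₊, ∞)` (`IsRadialSolution`), not identically zero, with the boundary behaviour of a
mode solution: `Δ R' R̄ → 0` at `r₊⁺` (the horizon condition (2.3) for `Im ω > 0`) and `R`, `R'`
exponentially decaying at infinity (finite energy). Then the mode is superradiant:
`2Mr₊|ω| < |am|`, i.e. `ω_R² + ω_I² < (am/2Mr₊)²`.
[cite: ShlapentokhRothman2014KleinGordon, Prop. 4.6] -/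
theorem superradiant_of_isRadialSolution (hMa : Kerr.IsSubextremal M a) (hw : 0 < w.im)
    (hΛ : ((Λ + ((a ^ 2 : ℝ) : ℂ) * w ^ 2) * conj w).im < 0)
    (hR : IsRadialSolution M a w m Λ μ R) (hne : ∃ r ∈ Ioi (Kerr.rPlus M a), R r ≠ 0)
    (hhor : Tendsto (fun r : ℝ ↦ ((Kerr.delta M a r : ℝ) : ℂ) * deriv R r * conj (R r))
      (𝓝[>] (Kerr.rPlus M a)) (𝓝 0))
    (hdec : ∃ C κ : ℝ, 0 < κ ∧ ∀ r : ℝ, Kerr.rPlus M a + 1 ≤ r →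
      ‖R r‖ ≤ C * Real.exp (-(κ * r)) ∧ ‖deriv R r‖ ≤ C * Real.exp (-(κ * r))) :
    2 * M * Kerr.rPlus M a * ‖w‖ < |a * m| := by
  set rp : ℝ := Kerr.rPlus M a with hrp_def
  have hM : 0 < M := hMa.pos
  have hrp : 0 < rp := hMa.rPlus_pos
  set V : ℝ → ℂ := kgRadialPotential M a w m Λ μ with hVdef
  set h : ℝ → ℝ := fun r ↦ (-(V r) * conj w).im with hhdef
  -- Suppose not: then `Im(-V ω̄)(r₊) ≥ 0`, hence `Im(-V ω̄) > 0` on `(r₊, ∞)`.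
  by_contra hcon
  push Not at hcon
  have h0 : 0 ≤ h rp := by
    simp only [hhdef, hVdef, hrp_def]
    rw [im_neg_kgRadialPotential_mul_conj_rPlus w m Λ μ hMa]
    refine mul_nonneg hw.le ?_
    have h1 : |a * m| ^ 2 ≤ (2 * M * Kerr.rPlus M a * ‖w‖) ^ 2 :=
      pow_le_pow_left₀ (abs_nonneg _) hcon 2
    rw [sq_abs] at h1
    nlinarith
  have hpos : ∀ r, rp < r → 0 < h r := fun r hr ↦
    im_neg_kgRadialPotential_mul_conj_pos w m Λ μ hMa hw hΛ h0 hr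
  -- the current `J = Im(Δ R' ω̄ R̄)` and `g = -J' = εΔ|R'|² + Im(-Vω̄)|R|²/Δ ≥ 0`
  set J : ℝ → ℝ := fun s ↦ (((Kerr.delta M a s : ℝ) : ℂ) * deriv R s * (conj w * conj (R s))).im
    with hJdef
  set g : ℝ → ℝ := fun r ↦ w.im * Kerr.delta M a r * ‖deriv R r‖ ^ 2 + h r * ‖R r‖ ^ 2 / Kerr.delta M a r
    with hgdef
  have hJ : ∀ r, rp < r → HasDerivAt J (-g r) r := by
    intro r hr
    have hd := hasDerivAt_radialCurrent hMa hR hr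
    refine hd.congr_deriv ?_
    simp only [hgdef, hhdef, neg_mul, Complex.neg_im]
    ring
  have hg0 : ∀ r, rp < r → 0 ≤ g r := by
    intro r hr
    have hΔ : 0 < Kerr.delta M a r := Kerr.delta_pos hMa.le hr
    simp only [hgdef]
    have := hpos r hr
    positivity
  -- continuity of `g` on `(r₊, ∞)`
  have hRcont : ContinuousOn R (Ioi rp) := hR.1.continuousOn
  have hR'cont : ContinuousOn (deriv R) (Ioi rp) :=
    hR.1.continuousOn_deriv_of_isOpen isOpen_Ioi (by simp)
  have hΔcont : Continuous (Kerr.delta M a) := by unfold Kerr.delta; fun_prop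
  have hVcont : Continuous V := by
    simp only [hVdef]
    unfold kgRadialPotential Kerr.delta
    fun_prop
  have hhcont : Continuous h := by
    simp only [hhdef]
    exact Complex.continuous_im.comp ((hVcont.neg).mul continuous_const)
  have hgcont : ContinuousOn g (Ioi rp) := by
    simp only [hgdef]
    refine ContinuousOn.add ?_ ?_
    · exact ((continuousOn_const.mul hΔcont.continuousOn).mul (hR'cont.norm.pow 2))
    · exact (hhcont.continuousOn.mul (hRcont.norm.pow 2)).div hΔcont.continuousOn
        fun r hr ↦ (Kerr.delta_pos hMa.le hr).ne'
  -- a window `[α, β] ⊂ (r₊, ∞)` on which `R ≠ 0`, hence `g > 0`, and `γ = ∫_α^β g > 0`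
  obtain ⟨r₁, hr₁, hRr₁⟩ := hne
  have hr₁' : rp < r₁ := hr₁
  have hnhds : ∀ᶠ s in 𝓝 r₁, R s ≠ 0 :=
    (hRcont.continuousAt (Ioi_mem_nhds hr₁')).eventually_ne hRr₁
  have hnhds' : ∀ᶠ s in 𝓝 r₁, rp < s := Ioi_mem_nhds hr₁'
  obtain ⟨δ, hδ, hδp⟩ := Metric.eventually_nhds_iff.1 (hnhds.and hnhds')
  set α : ℝ := r₁ - δ / 2 with hαdef
  set β : ℝ := r₁ + δ / 2 with hβdef
  have hαβ : α < β := by rw [hαdef, hβdef]; linarith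
  have hwin : ∀ s ∈ Icc α β, R s ≠ 0 ∧ rp < s := by
    intro s hs
    refine hδp ?_
    rw [dist_eq_norm, Real.norm_eq_abs, abs_lt]
    constructor <;> [linarith [hs.1]; linarith [hs.2]]
  have hα : rp < α := (hwin α (left_mem_Icc.2 hαβ.le)).2
  have hgpos : ∀ s ∈ Ioo α β, 0 < g s := by
    intro s hs
    obtain ⟨hRs, hs'⟩ := hwin s (Ioo_subset_Icc_self hs)
    have hΔ : 0 < Kerr.delta M a s := Kerr.delta_pos hMa.le hs'
    simp only [hgdef]
    have h1 : 0 ≤ w.im * Kerr.delta M a s * ‖deriv R s‖ ^ 2 := by positivity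
    have h2 : 0 < h s * ‖R s‖ ^ 2 / Kerr.delta M a s := by
      have := hpos s hs'
      have : 0 < ‖R s‖ := norm_pos_iff.2 hRs
      positivity
    linarith
  have hgi : ∀ x y : ℝ, rp < x → x ≤ y → IntervalIntegrable g volume x y := by
    intro x y hx hxy
    refine (hgcont.mono ?_).intervalIntegrable
    rw [uIcc_of_le hxy]
    exact fun s hs ↦ lt_of_lt_of_le hx hs.1
  set γ : ℝ := ∫ s in α..β, g s with hγdef
  have hγ : 0 < γ := intervalIntegral_pos_of_pos_on (hgi α β hα hαβ.le) hgpos hαβ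
  -- FTC: `J x - J T = ∫_x^T g ≥ γ` for `r₊ < x ≤ α`, `β ≤ T`
  have hkey : ∀ x T : ℝ, rp < x → x ≤ α → β ≤ T → γ + J T ≤ J x := by
    intro x T hx hxα hβT
    have hxT : x ≤ T := hxα.trans (hαβ.le.trans hβT)
    have hderiv : ∀ s ∈ uIcc x T, HasDerivAt J (-g s) s := by
      intro s hs
      rw [uIcc_of_le hxT] at hs
      exact hJ s (lt_of_lt_of_le hx hs.1)
    have hint : IntervalIntegrable (fun s ↦ -g s) volume x T := (hgi x T hx hxT).neg
    have hFTC := integral_eq_sub_of_hasDerivAt hderiv hint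
    rw [intervalIntegral.integral_neg] at hFTC
    -- `∫_x^T g ≥ ∫_α^β g`
    have hmono : γ ≤ ∫ s in x..T, g s := by
      refine integral_mono_interval hxα hαβ.le hβT ?_ (hgi x T hx hxT)
      refine (ae_restrict_mem measurableSet_Ioc).mono fun s hs ↦ hg0 s (lt_of_lt_of_le hx hs.1.le)
    linarith
  -- `J T → 0` as `T → ∞`
  obtain ⟨C, κ, hκ, hCd⟩ := hdec
  have hJinf : Tendsto J atTop (𝓝 0) := by
    have hbound : ∀ᶠ T in atTop, ‖J T‖ ≤ ‖w‖ * C ^ 2 * (Kerr.delta M a T * Real.exp (-(2 * κ * T))) := by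
      filter_upwards [eventually_ge_atTop (rp + 1)] with T hT
      have hT' : rp < T := by linarith
      have hΔ : 0 ≤ Kerr.delta M a T := (Kerr.delta_pos hMa.le hT').le
      obtain ⟨hRT, hR'T⟩ := hCd T hT
      have hC0 : 0 ≤ C := le_trans (norm_nonneg _) (hRT.trans_eq rfl) |> fun h ↦ by
        nlinarith [Real.exp_pos (-(κ * T)), norm_nonneg (R T)]
      simp only [hJdef, Real.norm_eq_abs]
      calc |(((Kerr.delta M a T : ℝ) : ℂ) * deriv R T * (conj w * conj (R T))).im|
          ≤ ‖((Kerr.delta M a T : ℝ) : ℂ) * deriv R T * (conj w * conj (R T))‖ :=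
            Complex.abs_im_le_norm _
        _ = Kerr.delta M a T * ‖deriv R T‖ * (‖w‖ * ‖R T‖) := by
            rw [norm_mul, norm_mul, norm_mul, Complex.norm_real, Real.norm_eq_abs, abs_of_nonneg hΔ,
              Complex.norm_conj, Complex.norm_conj]
        _ ≤ Kerr.delta M a T * (C * Real.exp (-(κ * T))) * (‖w‖ * (C * Real.exp (-(κ * T)))) := by
            gcongr
        _ = ‖w‖ * C ^ 2 * (Kerr.delta M a T * Real.exp (-(2 * κ * T))) := by
            rw [show -(2 * κ * T) = -(κ * T) + -(κ * T) by ring, Real.exp_add]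
            ring
    have hlim := (tendsto_delta_mul_exp_neg M a hκ).const_mul (‖w‖ * C ^ 2)
    rw [mul_zero] at hlim
    exact squeeze_zero_norm' hbound hlim
  -- hence `J x ≥ γ` for `r₊ < x ≤ α`
  have hJx : ∀ x, rp < x → x ≤ α → γ ≤ J x := by
    intro x hx hxα
    have hev : ∀ᶠ T in atTop, γ + J T ≤ J x := by
      filter_upwards [eventually_ge_atTop β] with T hT using hkey x T hx hxα hT
    have hlim : Tendsto (fun T ↦ γ + J T) atTop (𝓝 (γ + 0)) := hJinf.const_add γ
    rw [add_zero] at hlim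
    exact le_of_tendsto hlim hev
  -- but `J x → 0` as `x → r₊⁺`: contradiction
  have hJ0 : Tendsto J (𝓝[>] rp) (𝓝 0) := by
    have h1 : Tendsto (fun r : ℝ ↦ conj w * (((Kerr.delta M a r : ℝ) : ℂ) * deriv R r * conj (R r)))
        (𝓝[>] rp) (𝓝 (conj w * 0)) := hhor.const_mul _
    rw [mul_zero] at h1
    have h2 := (Complex.continuous_im.tendsto 0).comp h1
    simp only [Complex.zero_im] at h2
    refine h2.congr fun r ↦ ?_
    simp only [hJdef, Function.comp_apply]
    ring_nf
  have hev : ∀ᶠ x in 𝓝[>] rp, γ ≤ J x := by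
    have hmem : Ioo rp α ∈ 𝓝[>] rp := Ioo_mem_nhdsGT hα
    filter_upwards [hmem] with x hx using hJx x hx.1 hx.2.le
  have := ge_of_tendsto hJ0 hev
  linarith

end Superradiance

end Literature.Barriers.FinalStateConjecture

end
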